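import Literature.InformationTheory.QuantumCodes.ToricCodeThreshold
import Literature.InformationTheory.QuantumCodes.CodeCapacityNoise
import Literature.Probability.RandomPlanarGeometry.BDGS2012CountBoundsProofs
import Literature.Probability.RandomPlanarGeometry.SAWCount
import Mathlib.Analysis.SpecialFunctions.Pow.Real
import Mathlib.Analysis.SpecialFunctions.Sqrt
import HarnessLib

/-!
# Toric-code threshold under minimum-weight decoding: the certified instances of the
# Dennis–Kitaev–Landahl–Preskill counting bound (LADDER-QEC Q5, certified column)

Venture QEC, `Summits/Ventures/QEC/Thresholds/` (PARTITION v2 D2.1: "our proved threshold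
INSTANCES, e.g. the D4 parametric theorem's corollaries"; director-qec D4/D4′/D4″; qec-lead
FINDINGS row Q5-1). HONEST FRAMING: every theorem in this file is CONDITIONAL on the ONE named
fact `ToricCode.toricThreshold_of_sawCountBound` (Literature/…/ToricCodeThreshold.lean, the
DKLP 2002 §5.2–5.3 perfect-measurement statement, parametric in a per-length self-avoiding-walk
bound `∀ n, cₙ ≤ C ν^n`; STATEMENT ONLY until the Q5 provers land `…_holds`) — it is taken as the
explicit hypothesis `(h : toricThreshold_of_sawCountBound)` and nothing is asserted without it.
What IS proved here unconditionally is (a) the walk-count INPUTS, by IMPORT from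
`Literature/Probability/RandomPlanarGeometry` (never restated), in the hypothesis shape
`SAWCountBound C ν`, and (b) the arithmetic turning `4ν² p(1-p) < 1` into the interval
`0 ≤ p < p₀(ν) = (1 - √(1 - ν⁻²))/2`. The trust TIER of each instance is that of its walk-count
input (qec-ref-3 2026-08-26T16:16:02Z; ref/REFEREE-BUNDLE.md §5):

| instance | walk-count input (tree, by name) | `ν` | `p₀(ν)` | tier |
|---|---|---|---|---|
| `toricThreshold_elementary` | `SAW.Zd.count_succ_le` (`cₙ ≤ 4·3^{n-1}`, DKLP eq. (saw_d)) | `3` | `(3-2√2)/6 ≈ .02860` | CERTIFIED (kernel), given `h` |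
| `toricThreshold_memoryFour` (file `ToricCodeThresholdMemoryFour.lean`) | `SAW.Zd.count_le_two_mul_mul_memFourConst_pow` (`c_{3m+1} ≤ 4·26^m`) | `26^{1/3}` | `≈ .02935 > .0293` | CERTIFIED (kernel), given `h` |
| `toricThreshold_of_connectiveConstant_le` | `SAW.Zd.tendsto_count_rpow` (`cₙ^{1/n} → μ`) + ANY proved bound `μ ≤ μ'` | every `ν > μ'` | `p₀(μ')` | that of the bound `μ ≤ μ'` |
| `toricThreshold_PT2000` | the named fact `SAW.Zd.BDGS2012_connectiveConstant_two_bounds` (`μ ≤ 2.679193`, Pönitz–Tittmann) | `2.679193` | `≈ .03613 > .0361` | CERTIFIED-conditional (on `h` AND the fact) |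

The native-checked instance `ν = 2.688` (`SAW.FiniteMemory.checkC_18_2688`, `native_decide`,
axiom `Lean.ofReduceBool`, tier CHECKED-native, `p₀ ≈ .03589`) is kept OUT of this file so that
the axiom closure here stays `{propext, Classical.choice, Quot.sound}`; it lives in
`ToricCodeThresholdNative.lean`. NOT A THEOREM ANYWHERE: the printed `p < .0373` (DKLP eq.
(p_c_2d)) — it rests on the numerical estimate `μ₂ ≈ 2.638` (CLAIM; qec-ref-3 FINDING 15:11:57Z).
No Monte Carlo number appears in this file (the VALIDATED column is `bench/VALIDATED.tsv`).

## References

* [DennisEtAl2002] E. Dennis, A. Kitaev, A. Landahl, J. Preskill, J. Math. Phys. 43 (2002) 4452,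
  arXiv:quant-ph/0110143, §5.3 eqs. (saw_d), (saw_2), (threshold_2d)–(p_c_2d), (fail_2d).
* [BDGS2012] Bauerschmidt–Duminil-Copin–Goodman–Slade, *Lectures on self-avoiding walks*, §1.3
  eq. (1.13)–(1.14) (`μ ≤ 2d-1`; `μ(2) ≤ 2.679193` [Pönitz–Tittmann 2000]).
-/

noncomputable section

namespace Summit.Ventures.QEC.Thresholds

open Filter Topology Finset
open Literature.InformationTheory.QuantumCodes
open Literature.InformationTheory.QuantumCodes.ToricCode
open Literature.Probability.RandomPlanarGeometry

/-! ### The objects: decoder families and their failure-probability family -/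

/-- The failure-probability family `(L, p) ↦ Prob_fail` of a decoder family on the toric codes
under independent `Z`-errors of rate `p` (perfect syndrome measurement) — the object whose
vanishing as `L → ∞` defines "below threshold" (`BelowThreshold`, `IsThresholdLowerBound` of
`CodeCapacityNoise.lean`). [cite: DennisEtAl2002, §4.3 and §5.2 (Prob_fail)] -/
def toricFailureFamily (D : (L : ℕ) → ZDecoder (L + 1)) : ℕ → ℝ → ℝ :=
  fun L p => failureProb (L + 1) (D L) p

/-! ### The threshold value `p₀(ν)` attached to a walk-count growth rate `ν` -/

/-- `p₀(ν) = (1 - √(1 - ν⁻²))/2`: the smaller root of `4ν² p(1-p) = 1`, i.e. the largest `p₀ ≤ ½`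
such that `p̃ = p(1-p) < (4ν²)⁻¹` for all `0 ≤ p < p₀` (DKLP: "`p̃ < (4μ₂²)⁻¹ … or `p < …`").
[cite: DennisEtAl2002, §5.3 eqs. (threshold_2d)–(p_c_2d)] -/
def thresholdValue (ν : ℝ) : ℝ :=
  (1 - Real.sqrt (1 - 1 / ν ^ 2)) / 2

/-- `p₀(ν) ≤ ½`. [cite: DennisEtAl2002, §5.3 eq. (p_c_2d)] -/
theorem thresholdValue_le_half (ν : ℝ) : thresholdValue ν ≤ 1 / 2 := by
  unfold thresholdValue
  linarith [Real.sqrt_nonneg (1 - 1 / ν ^ 2)]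

/-- `0 ≤ p₀(ν)`. [cite: DennisEtAl2002, §5.3 eq. (p_c_2d)] -/
theorem thresholdValue_nonneg (ν : ℝ) : 0 ≤ thresholdValue ν := by
  unfold thresholdValue
  have h1 : Real.sqrt (1 - 1 / ν ^ 2) ≤ 1 := by
    rw [Real.sqrt_le_one]
    have : 0 ≤ 1 / ν ^ 2 := by positivity
    linarith
  linarith

/-- The defining identity `4 ν² p₀(ν) (1 - p₀(ν)) = 1` (for `ν ≥ 1`).
[cite: DennisEtAl2002, §5.3 eq. (threshold_2d)] -/
theorem four_mul_sq_mul_thresholdValue {ν : ℝ} (hν : 1 ≤ ν) :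
    4 * ν ^ 2 * (thresholdValue ν * (1 - thresholdValue ν)) = 1 := by
  unfold thresholdValue
  set s := Real.sqrt (1 - 1 / ν ^ 2) with hs
  have hν0 : 0 < ν := lt_of_lt_of_le one_pos hν
  have hx : 0 ≤ 1 - 1 / ν ^ 2 := by
    have : 1 / ν ^ 2 ≤ 1 := by
      rw [div_le_one (by positivity)]
      nlinarith
    linarith
  have hss : s ^ 2 = 1 - 1 / ν ^ 2 := by rw [hs, Real.sq_sqrt hx]
  have : (1 - s) / 2 * (1 - (1 - s) / 2) = (1 - s ^ 2) / 4 := by ring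
  rw [this, hss]
  field_simp
  ring

/-- `p₀` is antitone in the growth rate: a smaller walk-count base gives a larger threshold
(`1 ≤ ν₁ ≤ ν₂ ⇒ p₀(ν₂) ≤ p₀(ν₁)`). [cite: DennisEtAl2002, §5.3 (tighter bounds on n_SAP relax the threshold)] -/
theorem thresholdValue_antitone {ν₁ ν₂ : ℝ} (hν₁ : 1 ≤ ν₁) (h : ν₁ ≤ ν₂) :
    thresholdValue ν₂ ≤ thresholdValue ν₁ := by
  unfold thresholdValue
  have hν₁0 : 0 < ν₁ := lt_of_lt_of_le one_pos hν₁
  have h1 : 1 / ν₂ ^ 2 ≤ 1 / ν₁ ^ 2 := by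
    apply one_div_le_one_div_of_le (by positivity)
    exact pow_le_pow_left₀ hν₁0.le h 2
  have h2 : Real.sqrt (1 - 1 / ν₁ ^ 2) ≤ Real.sqrt (1 - 1 / ν₂ ^ 2) :=
    Real.sqrt_le_sqrt (by linarith)
  linarith

/-- `p(1-p)` is strictly increasing on `[0, ½)` in the form needed: `p < q`, `p + q < 1 ⇒
p(1-p) < q(1-q)`. [folklore] -/
theorem mul_one_sub_lt_mul_one_sub {p q : ℝ} (hpq : p < q) (h : p + q < 1) :
    p * (1 - p) < q * (1 - q) := by
  nlinarith

/-! ### The parametric corollary: `SAWCountBound C ν ⇒` threshold `≥ p₀(ν)` -/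

/-- Unpacking the named fact at one rate: under `SAWCountBound C ν`, a minimum-weight family is
below threshold at every `0 ≤ p ≤ ½` with `4ν² p(1-p) < 1`. CONDITIONAL on
`toricThreshold_of_sawCountBound`. [cite: DennisEtAl2002, §5.3 eq. (threshold_2d)] -/
theorem belowThreshold_of_sawCountBound (h : toricThreshold_of_sawCountBound) {C ν : ℝ}
    (hν : 0 < ν) (hc : SAWCountBound C ν) {D : (L : ℕ) → ZDecoder (L + 1)}
    (hD : ∀ L, (D L).IsMinWeight (syn (L + 1)) (cycles (L + 1)) hammingNorm) {p : ℝ} (hp₀ : 0 ≤ p) (hp : p ≤ 1 / 2)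
    (hlt : 4 * ν ^ 2 * (p * (1 - p)) < 1) : BelowThreshold (toricFailureFamily D) p :=
  h C ν hν hc D hD p hp₀ hp hlt

/-- **The D4″ parametric theorem, threshold form**: if `cₙ ≤ C ν^n` for all `n` (`ν ≥ 1`), then
`p₀(ν) = (1 - √(1 - ν⁻²))/2` is a lower bound on the accuracy threshold of every minimum-weight
decoder family of the toric code under independent bit-flip noise with perfect syndrome
measurement. CONDITIONAL on `toricThreshold_of_sawCountBound`.
[cite: DennisEtAl2002, §5.3 eqs. (threshold_2d)–(p_c_2d)] -/
theorem isThresholdLowerBound_of_sawCountBound (h : toricThreshold_of_sawCountBound) {C ν : ℝ}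
    (hν : 1 ≤ ν) (hc : SAWCountBound C ν) {D : (L : ℕ) → ZDecoder (L + 1)}
    (hD : ∀ L, (D L).IsMinWeight (syn (L + 1)) (cycles (L + 1)) hammingNorm) : IsThresholdLowerBound (toricFailureFamily D) (thresholdValue ν) := by
  intro p hp₀ hpp
  have hp : p ≤ 1 / 2 := hpp.le.trans (thresholdValue_le_half ν)
  have hlt : p * (1 - p) < thresholdValue ν * (1 - thresholdValue ν) :=
    mul_one_sub_lt_mul_one_sub hpp (by linarith [thresholdValue_le_half ν])
  have hν0 : 0 < ν := lt_of_lt_of_le one_pos hν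
  have h4 : 4 * ν ^ 2 * (p * (1 - p)) < 1 := by
    calc 4 * ν ^ 2 * (p * (1 - p)) < 4 * ν ^ 2 * (thresholdValue ν * (1 - thresholdValue ν)) := by
          gcongr
      _ = 1 := four_mul_sq_mul_thresholdValue hν
  exact belowThreshold_of_sawCountBound h hν0 hc hD hp₀ hp h4

/-- A `ν` that works for all larger bases: if `∃ C, cₙ ≤ C ν^n` for EVERY `ν > μ'` (`μ' ≥ 1`), then
already `p₀(μ')` is a threshold lower bound (for `p < p₀(μ')` pick `ν` strictly between).
CONDITIONAL on `toricThreshold_of_sawCountBound`. [cite: DennisEtAl2002, §5.3 eq. (threshold_2d)] -/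
theorem isThresholdLowerBound_of_forall_gt (h : toricThreshold_of_sawCountBound) {μ' : ℝ}
    (hμ' : 1 ≤ μ') (hc : ∀ ν : ℝ, μ' < ν → ∃ C : ℝ, SAWCountBound C ν)
    {D : (L : ℕ) → ZDecoder (L + 1)} (hD : ∀ L, (D L).IsMinWeight (syn (L + 1)) (cycles (L + 1)) hammingNorm) :
    IsThresholdLowerBound (toricFailureFamily D) (thresholdValue μ') := by
  intro p hp₀ hpp
  have hp : p ≤ 1 / 2 := hpp.le.trans (thresholdValue_le_half μ')
  have hlt : p * (1 - p) < thresholdValue μ' * (1 - thresholdValue μ') :=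
    mul_one_sub_lt_mul_one_sub hpp (by linarith [thresholdValue_le_half μ'])
  have hμ'0 : 0 < μ' := lt_of_lt_of_le one_pos hμ'
  -- `4 μ'² p(1-p) < 1`; choose `ν > μ'` with `4 ν² p(1-p) < 1` still
  have h4 : 4 * μ' ^ 2 * (p * (1 - p)) < 1 := by
    calc 4 * μ' ^ 2 * (p * (1 - p)) < 4 * μ' ^ 2 * (thresholdValue μ' * (1 - thresholdValue μ')) := by
          gcongr
      _ = 1 := four_mul_sq_mul_thresholdValue hμ'
  set K : ℝ := 4 * (p * (1 - p)) with hK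
  have hK0 : 0 ≤ K := by
    have : 0 ≤ 1 - p := by linarith
    positivity
  obtain ⟨ν, hμν, hνK⟩ : ∃ ν : ℝ, μ' < ν ∧ 4 * ν ^ 2 * (p * (1 - p)) < 1 := by
    rcases hK0.eq_or_lt with hK00 | hKpos
    · refine ⟨μ' + 1, by linarith, ?_⟩
      have : 4 * (μ' + 1) ^ 2 * (p * (1 - p)) = (μ' + 1) ^ 2 * K := by rw [hK]; ring
      rw [this, ← hK00, mul_zero]
      exact one_pos
    · -- `μ'² < 1/K`; take `t` strictly between and `ν = √t`
      have hlt' : μ' ^ 2 < 1 / K := by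
        rw [lt_div_iff₀ hKpos]
        calc μ' ^ 2 * K = 4 * μ' ^ 2 * (p * (1 - p)) := by rw [hK]; ring
          _ < 1 := h4
      obtain ⟨t, ht1, ht2⟩ := exists_between hlt'
      have ht0 : 0 < t := lt_of_le_of_lt (sq_nonneg _) ht1
      refine ⟨Real.sqrt t, ?_, ?_⟩
      · calc μ' = Real.sqrt (μ' ^ 2) := (Real.sqrt_sq hμ'0.le).symm
          _ < Real.sqrt t := Real.sqrt_lt_sqrt (sq_nonneg _) ht1
      · rw [Real.sq_sqrt ht0.le]
        calc 4 * t * (p * (1 - p)) = t * K := by rw [hK]; ring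
          _ < 1 / K * K := by gcongr
          _ = 1 := by field_simp
  obtain ⟨C, hC⟩ := hc ν hμν
  exact belowThreshold_of_sawCountBound h (hμ'0.trans hμν) hC hD hp₀ hp hνK

/-! ### Instance 1 (tier CERTIFIED): the elementary count `cₙ ≤ 4·3^{n-1}`, `ν = 3` -/

/-- DKLP's elementary walk count in the hypothesis shape: `cₙ ≤ (4/3)·3^n` (the tree's
`SAW.Zd.count_succ_le`: `c_{n+1} ≤ 2d(2d-1)^n`, with `c₀ = 1`).
[cite: DennisEtAl2002, §5.3 eq. (saw_d)] -/
theorem sawCountBound_three : SAWCountBound (4 / 3) 3 := by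
  intro n
  rw [← SAW.Zd.count_two]
  cases n with
  | zero =>
    have : SAW.Zd.count 2 0 = 1 := by rw [SAW.Zd.count_two]; exact SAW.count_zero
    rw [this]
    norm_num
  | succ n =>
    have h := SAW.Zd.count_succ_le 2 n
    have h' : (SAW.Zd.count 2 (n + 1) : ℝ) ≤ 4 * 3 ^ n := by exact_mod_cast h
    calc (SAW.Zd.count 2 (n + 1) : ℝ) ≤ 4 * 3 ^ n := h'
      _ = 4 / 3 * 3 ^ (n + 1) := by ring

/-- **Toric-code threshold, elementary-count instance (tier CERTIFIED, given `h`)**: for every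
minimum-weight decoder family, `p₀(3) = (1 - √(8/9))/2 = (3 - 2√2)/6 ≈ .02860` is a lower bound on
the accuracy threshold under independent bit-flip noise with perfect syndrome measurement.
CONDITIONAL on `toricThreshold_of_sawCountBound`. [cite: DennisEtAl2002, §5.3 eqs. (saw_d), (threshold_2d)] -/
theorem toricThreshold_elementary (h : toricThreshold_of_sawCountBound)
    {D : (L : ℕ) → ZDecoder (L + 1)} (hD : ∀ L, (D L).IsMinWeight (syn (L + 1)) (cycles (L + 1)) hammingNorm) :
    IsThresholdLowerBound (toricFailureFamily D) (thresholdValue 3) :=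
  isThresholdLowerBound_of_sawCountBound h (by norm_num) sawCountBound_three hD

/-- The elementary threshold value in closed form: `p₀(3) = (3 - 2√2)/6`.
[cite: DennisEtAl2002, §5.3 eq. (p_c_2d) (with μ replaced by 3)] -/
theorem thresholdValue_three : thresholdValue 3 = (3 - 2 * Real.sqrt 2) / 6 := by
  unfold thresholdValue
  have h89 : (1 - 1 / (3 : ℝ) ^ 2) = (2 * Real.sqrt 2 / 3) ^ 2 := by
    rw [div_pow, mul_pow, Real.sq_sqrt (by norm_num : (0 : ℝ) ≤ 2)]
    norm_num
  rw [h89, Real.sqrt_sq (by positivity)]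
  ring

/-- Decimal enclosure of the elementary value: `.0285 < p₀(3) < .0286` (so the rounded ".0286"
quoted on the cell's STATUS is an upper rounding; the certified statement is `p < (3-2√2)/6`).
[cite: DennisEtAl2002, §5.3 eq. (p_c_2d)] -/
theorem thresholdValue_three_bounds : (0.0285 : ℝ) < thresholdValue 3 ∧ thresholdValue 3 < 0.0286 := by
  unfold thresholdValue
  have hx : (1 - 1 / (3 : ℝ) ^ 2) = 8 / 9 := by norm_num
  rw [hx]
  constructor
  · have : Real.sqrt (8 / 9) < 0.943 := by
      rw [Real.sqrt_lt' (by norm_num)]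
      norm_num
    linarith
  · have : (0.9428 : ℝ) < Real.sqrt (8 / 9) := by
      rw [Real.lt_sqrt (by norm_num)]
      norm_num
    linarith

/-! ### Instance 3 (tier = that of the `μ` bound): any proved `μ(ℤ²) ≤ μ'` -/

/-- From `cₙ^{1/n} → μ` (the tree's `SAW.Zd.tendsto_count_rpow`, Fekete): every `ν > μ` admits a
constant `C` with `cₙ ≤ C ν^n` for all `n`. [cite: BDGS2012, §1.3 eq. (1.12)] -/
theorem exists_sawCountBound_of_connectiveConstant_lt {ν : ℝ}
    (hν : SAW.Zd.connectiveConstant 2 < ν) : ∃ C : ℝ, SAWCountBound C ν := by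
  have hν0 : 0 < ν := lt_of_lt_of_le' hν (SAW.Zd.connectiveConstant_pos 2).le
  have ht := SAW.Zd.tendsto_count_rpow 2
  have hev : ∀ᶠ n : ℕ in atTop, (SAW.Zd.count 2 n : ℝ) ^ (1 / (n : ℝ)) < ν :=
    ht (Iio_mem_nhds hν)
  obtain ⟨N, hN⟩ := eventually_atTop.1 hev
  -- beyond `N` (and `n ≥ 1`): `cₙ < ν^n`
  have hlarge : ∀ n : ℕ, N ≤ n → 1 ≤ n → (SAW.Zd.count 2 n : ℝ) ≤ ν ^ n := by
    intro n hn hn1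
    have h1 := hN n hn
    have hc0 : (0 : ℝ) ≤ SAW.Zd.count 2 n := Nat.cast_nonneg _
    have hn0 : (n : ℝ) ≠ 0 := by exact_mod_cast (show n ≠ 0 by omega)
    have : ((SAW.Zd.count 2 n : ℝ) ^ (1 / (n : ℝ))) ^ (n : ℝ) = SAW.Zd.count 2 n := by
      rw [← Real.rpow_mul hc0, one_div_mul_cancel hn0, Real.rpow_one]
    calc (SAW.Zd.count 2 n : ℝ) = ((SAW.Zd.count 2 n : ℝ) ^ (1 / (n : ℝ))) ^ (n : ℝ) := this.symm
      _ ≤ ν ^ (n : ℝ) := Real.rpow_le_rpow (Real.rpow_nonneg hc0 _) h1.le (Nat.cast_nonneg n)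
      _ = ν ^ n := Real.rpow_natCast ν n
  -- a constant absorbing the finitely many small `n`
  refine ⟨∑ k ∈ Finset.range (N + 1), (SAW.Zd.count 2 k : ℝ) / ν ^ k, fun n => ?_⟩
  rw [← SAW.Zd.count_two]
  have hterm : ∀ k, 0 ≤ (SAW.Zd.count 2 k : ℝ) / ν ^ k := fun k => by positivity
  have hC1 : (1 : ℝ) ≤ ∑ k ∈ Finset.range (N + 1), (SAW.Zd.count 2 k : ℝ) / ν ^ k := by
    have h0 : (SAW.Zd.count 2 0 : ℝ) / ν ^ 0 = 1 := by
      rw [SAW.Zd.count_two, SAW.count_zero]; simp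
    calc (1 : ℝ) = (SAW.Zd.count 2 0 : ℝ) / ν ^ 0 := h0.symm
      _ ≤ ∑ k ∈ Finset.range (N + 1), (SAW.Zd.count 2 k : ℝ) / ν ^ k :=
          Finset.single_le_sum (fun k _ => hterm k) (Finset.mem_range.2 (Nat.succ_pos N))
  by_cases hn : n ≤ N
  · -- small `n`: `cₙ = (cₙ/ν^n) ν^n ≤ C ν^n`
    have hmem : n ∈ Finset.range (N + 1) := Finset.mem_range.2 (Nat.lt_succ_of_le hn)
    have hle : (SAW.Zd.count 2 n : ℝ) / ν ^ n ≤ ∑ k ∈ Finset.range (N + 1), (SAW.Zd.count 2 k : ℝ) / ν ^ k :=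
      Finset.single_le_sum (fun k _ => hterm k) hmem
    have hνn : 0 < ν ^ n := pow_pos hν0 n
    calc (SAW.Zd.count 2 n : ℝ) = (SAW.Zd.count 2 n : ℝ) / ν ^ n * ν ^ n := by field_simp
      _ ≤ (∑ k ∈ Finset.range (N + 1), (SAW.Zd.count 2 k : ℝ) / ν ^ k) * ν ^ n := by gcongr
  · push Not at hn
    have hn1 : 1 ≤ n := by omega
    calc (SAW.Zd.count 2 n : ℝ) ≤ ν ^ n := hlarge n hn.le hn1
      _ = 1 * ν ^ n := (one_mul _).symm
      _ ≤ (∑ k ∈ Finset.range (N + 1), (SAW.Zd.count 2 k : ℝ) / ν ^ k) * ν ^ n := by gcongr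

/-- **Toric-code threshold from any bound on the connective constant** (tier = the tier of that
bound): if `μ(ℤ²) ≤ μ'` with `μ' ≥ 1`, then `p₀(μ')` is a threshold lower bound for every
minimum-weight decoder family. CONDITIONAL on `toricThreshold_of_sawCountBound`.
[cite: DennisEtAl2002, §5.3 eqs. (saw_2), (threshold_2d)] -/
theorem toricThreshold_of_connectiveConstant_le (h : toricThreshold_of_sawCountBound) {μ' : ℝ}
    (hμ'1 : 1 ≤ μ') (hμ : SAW.Zd.connectiveConstant 2 ≤ μ')
    {D : (L : ℕ) → ZDecoder (L + 1)} (hD : ∀ L, (D L).IsMinWeight (syn (L + 1)) (cycles (L + 1)) hammingNorm) :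
    IsThresholdLowerBound (toricFailureFamily D) (thresholdValue μ') :=
  isThresholdLowerBound_of_forall_gt h hμ'1
    (fun _ hν => exists_sawCountBound_of_connectiveConstant_lt (lt_of_le_of_lt hμ hν)) hD

/-! ### Instance 4 (tier CERTIFIED-conditional): the Pönitz–Tittmann value `μ ≤ 2.679193` -/

/-- **Toric-code threshold, Pönitz–Tittmann instance (tier CERTIFIED-conditional)**: granted the
named fact `SAW.Zd.BDGS2012_connectiveConstant_two_bounds` (`μ(ℤ²) ≤ 2.679193`, BDGS2012 eq.
(1.14), Pönitz–Tittmann 2000), `p₀(2.679193) ≈ .03613` is a threshold lower bound for every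
minimum-weight decoder family. CONDITIONAL on `toricThreshold_of_sawCountBound` AND on the
connective-constant fact. (DKLP's printed `.0373` would need `μ ≤ 2.638`, a numerical estimate —
CLAIM, not typed.) [cite: DennisEtAl2002, §5.3 eqs. (saw_2), (p_c_2d)] -/
theorem toricThreshold_PT2000 (h : toricThreshold_of_sawCountBound)
    (hμ : SAW.Zd.BDGS2012_connectiveConstant_two_bounds)
    {D : (L : ℕ) → ZDecoder (L + 1)} (hD : ∀ L, (D L).IsMinWeight (syn (L + 1)) (cycles (L + 1)) hammingNorm) :
    IsThresholdLowerBound (toricFailureFamily D) (thresholdValue 2.679193) :=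
  toricThreshold_of_connectiveConstant_le h (by norm_num) hμ.2 hD

/-- Decimal certificate: `.0361 < p₀(2.679193)`. [cite: DennisEtAl2002, §5.3 eq. (p_c_2d)] -/
theorem thresholdValue_PT2000_gt : (0.0361 : ℝ) < thresholdValue 2.679193 := by
  unfold thresholdValue
  have : Real.sqrt (1 - 1 / (2.679193 : ℝ) ^ 2) < 0.9278 := by
    rw [Real.sqrt_lt' (by norm_num)]
    norm_num
  linarith

/-- The kernel-only elementary bound on the connective constant, `μ(ℤ²) ≤ 3` (the tree's
`SAW.Zd.connectiveConstant_le`), gives back Instance 1's value through Instance 3 — a consistency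
check of the two routes. CONDITIONAL on `toricThreshold_of_sawCountBound`.
[cite: BDGS2012, §1.3 eq. (1.13)] -/
theorem toricThreshold_elementary' (h : toricThreshold_of_sawCountBound)
    {D : (L : ℕ) → ZDecoder (L + 1)} (hD : ∀ L, (D L).IsMinWeight (syn (L + 1)) (cycles (L + 1)) hammingNorm) :
    IsThresholdLowerBound (toricFailureFamily D) (thresholdValue 3) := by
  have hμ : SAW.Zd.connectiveConstant 2 ≤ 3 := by
    have := SAW.Zd.connectiveConstant_le 2 (by norm_num)
    norm_num at this
    exact this
  exact toricThreshold_of_connectiveConstant_le h (by norm_num) hμ hD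

/-! ### The accuracy threshold `p_c` itself (appended 2026-08-26, qec-type-09)

The corollaries below restate the instances as lower bounds on the number
`accuracyThreshold (toricFailureFamily D)` of `CodeCapacityNoise.lean` (the supremum of the
threshold lower bounds), via `le_accuracyThreshold`; same tiers, same hypothesis `h`. -/

/-- Under `SAWCountBound C ν` (`ν ≥ 1`), the accuracy threshold of every minimum-weight decoder
family is at least `p₀(ν)`. CONDITIONAL on `toricThreshold_of_sawCountBound`.
[cite: DennisEtAl2002, §5.3 (lower bound on the accuracy threshold)] -/
theorem thresholdValue_le_accuracyThreshold (h : toricThreshold_of_sawCountBound) {C ν : ℝ}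
    (hν : 1 ≤ ν) (hc : SAWCountBound C ν) {D : (L : ℕ) → ZDecoder (L + 1)}
    (hD : ∀ L, (D L).IsMinWeight (syn (L + 1)) (cycles (L + 1)) hammingNorm) :
    thresholdValue ν ≤ accuracyThreshold (toricFailureFamily D) :=
  le_accuracyThreshold (isThresholdLowerBound_of_sawCountBound h hν hc hD)
    ((thresholdValue_le_half ν).trans (by norm_num))

/-- **`p_c ≥ (3 - 2√2)/6 ≈ .0286`** for every minimum-weight decoder family of the toric code under
independent bit flips with perfect measurement (tier CERTIFIED, given `h`). CONDITIONAL on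
`toricThreshold_of_sawCountBound`. [cite: DennisEtAl2002, §5.3 eqs. (saw_d), (p_c_2d)] -/
theorem accuracyThreshold_ge_elementary (h : toricThreshold_of_sawCountBound)
    {D : (L : ℕ) → ZDecoder (L + 1)}
    (hD : ∀ L, (D L).IsMinWeight (syn (L + 1)) (cycles (L + 1)) hammingNorm) :
    (3 - 2 * Real.sqrt 2) / 6 ≤ accuracyThreshold (toricFailureFamily D) := by
  rw [← thresholdValue_three]
  exact thresholdValue_le_accuracyThreshold h (by norm_num) sawCountBound_three hD

/-- **`p_c > .0361`** for every minimum-weight decoder family, granted the Pönitz–Tittmann value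
`μ(ℤ²) ≤ 2.679193` (tier CERTIFIED-conditional). CONDITIONAL on `toricThreshold_of_sawCountBound`
AND `SAW.Zd.BDGS2012_connectiveConstant_two_bounds`. [cite: DennisEtAl2002, §5.3 eqs. (saw_2), (p_c_2d)] -/
theorem accuracyThreshold_gt_PT2000 (h : toricThreshold_of_sawCountBound)
    (hμ : SAW.Zd.BDGS2012_connectiveConstant_two_bounds) {D : (L : ℕ) → ZDecoder (L + 1)}
    (hD : ∀ L, (D L).IsMinWeight (syn (L + 1)) (cycles (L + 1)) hammingNorm) :
    (0.0361 : ℝ) < accuracyThreshold (toricFailureFamily D) :=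
  lt_of_lt_of_le thresholdValue_PT2000_gt
    (le_accuracyThreshold (toricThreshold_PT2000 h hμ hD)
      ((thresholdValue_le_half _).trans (by norm_num)))

end Summit.Ventures.QEC.Thresholds

end
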